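import Summits.AtomisticToContinuum.BoseEinsteinCondensation.Theorems.BECThomsonPrincipleGDTransferSeededKineticBlockDiagonal
import Summits.AtomisticToContinuum.BoseEinsteinCondensation.Theorems.BECThomsonPrincipleGDTransferSeededInteractionLocality
import Summits.AtomisticToContinuum.BoseEinsteinCondensation.Theorems.BECThomsonPrincipleGDTransferSeededSectorBlockAlgebra
import Summits.AtomisticToContinuum.BoseEinsteinCondensation.Theorems.BECThomsonPrincipleGDTransferSeededSharpCutSplitting
import Summits.AtomisticToContinuum.BoseEinsteinCondensation.Theorems.BECThomsonPrincipleGDTransferSeededLawLocalConstancy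
import Summits.AtomisticToContinuum.BoseEinsteinCondensation.Theorems.BECThomsonPrincipleGDTransferSeededPointwiseCatExclusion
import Summits.AtomisticToContinuum.BoseEinsteinCondensation.Theorems.BECThomsonPrincipleGDTransferSeededFixedNNoBalancedCat

/-!
# Route `BECThomsonPrinciple`, crux `GDTransfer` (stmt-AtomisticToContinuum-9482), line `seeded-continuity` —
# fixed-`N` seed programme: ASSEMBLY — the seed holds at every fixed particle number (registered sub-goal
# `fixedNNoBalancedCat_holds`)

Supports (does not close) stmt-AtomisticToContinuum-9482.  Composes the seven landed pieces of the lead's fixed-`N` seed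
programme (`…SeededGradingDefs`): the `n̂₀`-grading of the energy form (`kineticBlockDiagonal`, `interactionLocality`), the
sharp cut (`sectorBlockAlgebra`, `sharpCutSplitting`), pointwise cat exclusion (`pointwiseCatExclusion`), local constancy of the
whole law (`lawLocalConstancy`) and the compactness/corner patch (`fixedN_noBalancedCat`) into the unconditional theorem
`FixedNNoBalancedCat`: for every admissible finite continuous pair potential and band parameters `θ, β`, for every large `N`
and every `L_min > 0` ONE threshold `τ < 1/2` excludes balanced cats among the small-slack near-minimisers at every side
`L ≥ L_min`.  The registered seed `stub_noBalancedCat : NoBalancedCat` of the line is the same statement with `τ` chosen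
BEFORE `N`; its open content is therefore exactly the uniformity of `τ` in `N`.

References: ReedSimonIV1978 §XIII.12; LSSY2005 §1.2, Ch. 5; KennedyLiebShastry1988.
-/

noncomputable section

namespace Summit.AtomisticToContinuum.BoseEinsteinCondensation.Cruxes.GDTransfer.Seeded

/-- **The fixed-`N` seed holds** (line `seeded-continuity`, crux `GDTransfer`, stmt-AtomisticToContinuum-9482): `NoBalancedCat`
with the threshold chosen after the particle number, for every admissible finite continuous pair potential — unconditional.
[cite: ReedSimonIV1978, §XIII.12] -/
theorem fixedNNoBalancedCat_holds : FixedNNoBalancedCat :=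
  fixedN_noBalancedCat (pointwiseCatExclusion sectorBlockAlgebra
    (sharpCutSplitting kineticBlockDiagonal interactionLocality sectorBlockAlgebra)) lawLocalConstancy

end Summit.AtomisticToContinuum.BoseEinsteinCondensation.Cruxes.GDTransfer.Seeded

end
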